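import Literature.MathematicalPhysics.QuantumLattice.HubbardTTPrimeThermalPhaseCoexistence
import Literature.MathematicalPhysics.QuantumLattice.HubbardTTPrimeMeanEnergySupergradient
import HarnessLib

/-!
# Jumps across a first-order transition of the 2D `t–t'` Hubbard model at `T > 0` are bounded by the pressure curvature:
# latent heat, magnetisation, double occupancy, diagonal-hopping energy

Topic `Literature/MathematicalPhysics/QuantumLattice`; coordinate instances of the joint tangent plane FOR THE PHASES of
`HubbardTTPrimeThermalPhaseCoexistence.lean` (`IsTorusLimitOfMixture.gcPressureTT'Zeeman_sub_le_of_mix_left`: if a thermal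
grand-canonical state at `(β; x)`, `x = (t,t',U,μ,h)`, is a non-trivial mixture `λω₁ + (1−λ)ω₂` of translation-invariant states, then
`P(β;x) − [β₁u_{x₁}(ω_i) − βu_x(ω_i)] ≤ P(β₁;x₁)` for EACH phase `ω_i`). Writing `Δ²_v P(δ) = P(v+δ) + P(v−δ) − 2P(v)` for the
second difference of the pressure in the coordinate `v` (a certified number from three pressures), PROVED (`β ≥ 0`, `U ≥ 0`,
`0 < λ < 1`, `δ > 0`):

* `abs_energy_sub_energy_le_of_mix` (`δ ≤ β`): **LATENT HEAT** `|u_x(ω₁) − u_x(ω₂)| ≤ Δ²_β P(δ)/δ`;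
* `abs_magnetisation_sub_le_of_mix` (`β > 0`): `|m(ω₁) − m(ω₂)| ≤ Δ²_h P(δ)/(βδ)`;
* `abs_docc_sub_le_of_mix` (`β > 0`, `δ ≤ U`): `|D(ω₁) − D(ω₂)| ≤ Δ²_U P(δ)/(βδ)` (`D(ω) = e_{Φ(0,0,1)}(ω)` the double-occupancy density);
* `abs_diagHop_sub_le_of_mix` (`β > 0`): `|K₂(ω₁) − K₂(ω₂)| ≤ Δ²_{t'} P(δ)/(βδ)` (`K₂ = e_{Φ(0,1,0)}`);
together with the density jump of the parent file. With certificates `W ≤ P(v)`, `P(v±δ) ≤ Q±` each reads `… ≤ (Q₊ + Q₋ − 2W)/(…)`.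

Everything is PROVED; no definition, no named fact.

## Mathlib / tree search

REUSED: `IsTorusLimitOfMixture.gcPressureTT'Zeeman_sub_le_of_mix_left`, `mix_comm` (`HubbardTTPrimeThermalPhaseCoexistence`);
`meanEnergy_hubbardTTPrime_affine` (`HubbardTTPrimeMeanEnergySupergradient`). `lean search 'latent heat|of_mix'`: nothing else (2026-08-27).

## References

* R. B. Israel, *Convexity in the Theory of Lattice Gases* (1979), Thm. I.2.4, §III. [cite: Israel1979, Thm. I.2.4]
* R. B. Griffiths, J. Math. Phys. 5 (1964) 1215. [cite: Griffiths1964]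
-/

noncomputable section

open scoped ComplexOrder BigOperators
open Finset Literature.InformationTheory.Entropy

namespace Literature.MathematicalPhysics.QuantumLattice

open Matrix HubbardWave0 Literature.Probability.LatticeModels ThermodynamicLimit
open _root_.Filter
open scoped _root_.Topology

namespace InfVolFermionState

variable {β : ℝ} (hβ : 0 ≤ β) (t t' : ℝ) {U : ℝ} (hU : 0 ≤ U) (μ hz : ℝ)
  {ω₁ ω₂ : InfVolFermionState 2} {Ls : ℕ → ℕ}
include hβ hU

/-- **Two-sided energy bracket for a phase** (`0 < δ ≤ β`): `(P(β) − P(β+δ))/δ ≤ u_x(ω₁) ≤ (P(β−δ) − P(β))/δ` for the first phase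
`ω₁` of a coexisting pair. [cite: Griffiths1964] -/
theorem IsTorusLimitOfMixture.energy_mem_Icc_of_mix_left
    (h₁ : ω₁.IsTranslationInvariant) (h₂ : ω₂.IsTranslationInvariant) {lam : ℝ} (hl0 : 0 < lam) (hl1 : lam ≤ 1)
    (hω : (InfVolFermionState.mix lam hl0.le hl1 ω₁ ω₂).IsTorusLimitOfMixture sourcedGibbsCount (gcGibbsWeightTT' β t t' U μ hz)
      (gcGibbsVectorTT' t t' U μ hz) Ls)
    (hLs : Tendsto Ls atTop atTop) {δ : ℝ} (hδ : 0 < δ) (hδβ : δ ≤ β) :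
    ω₁.meanEnergy (hubbardTTPrimeFermionInteraction t t' U) 1 - μ * ω₁.density -
        hz * ((ω₁.expect ({0} : Finset (Site 2)) (nAt 0 (mem_singleton_self 0) 0)).re -
          (ω₁.expect ({0} : Finset (Site 2)) (nAt 0 (mem_singleton_self 0) 1)).re) ∈ Set.Icc
      ((gcPressureTT'Zeeman β t t' U μ hz - gcPressureTT'Zeeman (β + δ) t t' U μ hz) / δ)
      ((gcPressureTT'Zeeman (β - δ) t t' U μ hz - gcPressureTT'Zeeman β t t' U μ hz) / δ) := by
  have hp := hω.gcPressureTT'Zeeman_sub_le_of_mix_left hβ t t' hU μ hz h₁ h₂ hl0 hl1 hLs (by linarith : 0 ≤ β + δ) t t' hU μ hz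
  have hm := hω.gcPressureTT'Zeeman_sub_le_of_mix_left hβ t t' hU μ hz h₁ h₂ hl0 hl1 hLs (by linarith : 0 ≤ β - δ) t t' hU μ hz
  constructor
  · rw [div_le_iff₀ hδ]; nlinarith [hp]
  · rw [le_div_iff₀ hδ]; nlinarith [hm]

/-- **LATENT HEAT BOUND** (`0 < δ ≤ β`, `0 < λ < 1`): the energy densities of two coexisting phases differ by at most the second
difference of the pressure in `β`: `|u_x(ω₁) − u_x(ω₂)| ≤ (P(β+δ) + P(β−δ) − 2P(β))/δ`. [cite: Israel1979, Thm. I.2.4] [cite: Griffiths1964] -/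
theorem IsTorusLimitOfMixture.abs_energy_sub_energy_le_of_mix
    (h₁ : ω₁.IsTranslationInvariant) (h₂ : ω₂.IsTranslationInvariant) {lam : ℝ} (hl0 : 0 < lam) (hl1 : lam < 1)
    (hω : (InfVolFermionState.mix lam hl0.le hl1.le ω₁ ω₂).IsTorusLimitOfMixture sourcedGibbsCount (gcGibbsWeightTT' β t t' U μ hz)
      (gcGibbsVectorTT' t t' U μ hz) Ls)
    (hLs : Tendsto Ls atTop atTop) {δ : ℝ} (hδ : 0 < δ) (hδβ : δ ≤ β) :
    |(ω₁.meanEnergy (hubbardTTPrimeFermionInteraction t t' U) 1 - μ * ω₁.density -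
        hz * ((ω₁.expect ({0} : Finset (Site 2)) (nAt 0 (mem_singleton_self 0) 0)).re -
          (ω₁.expect ({0} : Finset (Site 2)) (nAt 0 (mem_singleton_self 0) 1)).re)) -
      (ω₂.meanEnergy (hubbardTTPrimeFermionInteraction t t' U) 1 - μ * ω₂.density -
        hz * ((ω₂.expect ({0} : Finset (Site 2)) (nAt 0 (mem_singleton_self 0) 0)).re -
          (ω₂.expect ({0} : Finset (Site 2)) (nAt 0 (mem_singleton_self 0) 1)).re))| ≤
      (gcPressureTT'Zeeman (β + δ) t t' U μ hz + gcPressureTT'Zeeman (β - δ) t t' U μ hz -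
        2 * gcPressureTT'Zeeman β t t' U μ hz) / δ := by
  obtain ⟨a₁, b₁⟩ := hω.energy_mem_Icc_of_mix_left hβ t t' hU μ hz h₁ h₂ hl0 hl1.le hLs hδ hδβ
  have hω' : (InfVolFermionState.mix (1 - lam) (by linarith) (by linarith) ω₂ ω₁).IsTorusLimitOfMixture sourcedGibbsCount
      (gcGibbsWeightTT' β t t' U μ hz) (gcGibbsVectorTT' t t' U μ hz) Ls := by
    rw [← mix_comm]; exact hω
  obtain ⟨a₂, b₂⟩ := hω'.energy_mem_Icc_of_mix_left hβ t t' hU μ hz h₂ h₁ (by linarith) (by linarith) hLs hδ hδβ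
  rw [div_le_iff₀ hδ] at a₁ a₂
  rw [le_div_iff₀ hδ] at b₁ b₂
  rw [abs_sub_le_iff]
  constructor
  · rw [le_div_iff₀ hδ]; linarith
  · rw [le_div_iff₀ hδ]; linarith

/-- **Magnetisation bracket for a phase** (`β > 0`, `δ > 0`): `βm(ω₁)δ ≤ P(h+δ) − P(h)` and `−βm(ω₁)δ ≤ P(h−δ) − P(h)`.
[cite: Griffiths1964] -/
theorem IsTorusLimitOfMixture.magnetisation_brackets_of_mix_left
    (h₁ : ω₁.IsTranslationInvariant) (h₂ : ω₂.IsTranslationInvariant) {lam : ℝ} (hl0 : 0 < lam) (hl1 : lam ≤ 1)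
    (hω : (InfVolFermionState.mix lam hl0.le hl1 ω₁ ω₂).IsTorusLimitOfMixture sourcedGibbsCount (gcGibbsWeightTT' β t t' U μ hz)
      (gcGibbsVectorTT' t t' U μ hz) Ls)
    (hLs : Tendsto Ls atTop atTop) (δ : ℝ) :
    β * ((ω₁.expect ({0} : Finset (Site 2)) (nAt 0 (mem_singleton_self 0) 0)).re -
          (ω₁.expect ({0} : Finset (Site 2)) (nAt 0 (mem_singleton_self 0) 1)).re) * δ ≤
        gcPressureTT'Zeeman β t t' U μ (hz + δ) - gcPressureTT'Zeeman β t t' U μ hz ∧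
      -(β * ((ω₁.expect ({0} : Finset (Site 2)) (nAt 0 (mem_singleton_self 0) 0)).re -
          (ω₁.expect ({0} : Finset (Site 2)) (nAt 0 (mem_singleton_self 0) 1)).re) * δ) ≤
        gcPressureTT'Zeeman β t t' U μ (hz - δ) - gcPressureTT'Zeeman β t t' U μ hz := by
  have hp := hω.gcPressureTT'Zeeman_sub_le_of_mix_left hβ t t' hU μ hz h₁ h₂ hl0 hl1 hLs hβ t t' hU μ (hz + δ)
  have hm := hω.gcPressureTT'Zeeman_sub_le_of_mix_left hβ t t' hU μ hz h₁ h₂ hl0 hl1 hLs hβ t t' hU μ (hz - δ)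
  constructor
  · nlinarith [hp]
  · nlinarith [hm]

/-- **MAGNETISATION JUMP BOUND** (`β > 0`, `δ > 0`, `0 < λ < 1`): `|m(ω₁) − m(ω₂)| ≤ (P(h+δ) + P(h−δ) − 2P(h))/(βδ)`.
[cite: Israel1979, Thm. I.2.4] [cite: Griffiths1964] -/
theorem IsTorusLimitOfMixture.abs_magnetisation_sub_le_of_mix (hβ' : 0 < β)
    (h₁ : ω₁.IsTranslationInvariant) (h₂ : ω₂.IsTranslationInvariant) {lam : ℝ} (hl0 : 0 < lam) (hl1 : lam < 1)
    (hω : (InfVolFermionState.mix lam hl0.le hl1.le ω₁ ω₂).IsTorusLimitOfMixture sourcedGibbsCount (gcGibbsWeightTT' β t t' U μ hz)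
      (gcGibbsVectorTT' t t' U μ hz) Ls)
    (hLs : Tendsto Ls atTop atTop) {δ : ℝ} (hδ : 0 < δ) :
    |((ω₁.expect ({0} : Finset (Site 2)) (nAt 0 (mem_singleton_self 0) 0)).re -
        (ω₁.expect ({0} : Finset (Site 2)) (nAt 0 (mem_singleton_self 0) 1)).re) -
      ((ω₂.expect ({0} : Finset (Site 2)) (nAt 0 (mem_singleton_self 0) 0)).re -
        (ω₂.expect ({0} : Finset (Site 2)) (nAt 0 (mem_singleton_self 0) 1)).re)| ≤
      (gcPressureTT'Zeeman β t t' U μ (hz + δ) + gcPressureTT'Zeeman β t t' U μ (hz - δ) -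
        2 * gcPressureTT'Zeeman β t t' U μ hz) / (β * δ) := by
  obtain ⟨a₁, b₁⟩ := hω.magnetisation_brackets_of_mix_left hβ t t' hU μ hz h₁ h₂ hl0 hl1.le hLs δ
  have hω' : (InfVolFermionState.mix (1 - lam) (by linarith) (by linarith) ω₂ ω₁).IsTorusLimitOfMixture sourcedGibbsCount
      (gcGibbsWeightTT' β t t' U μ hz) (gcGibbsVectorTT' t t' U μ hz) Ls := by
    rw [← mix_comm]; exact hω
  obtain ⟨a₂, b₂⟩ := hω'.magnetisation_brackets_of_mix_left hβ t t' hU μ hz h₂ h₁ (by linarith) (by linarith) hLs δ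
  have hβδ : 0 < β * δ := mul_pos hβ' hδ
  rw [abs_sub_le_iff]
  constructor
  · rw [le_div_iff₀ hβδ]; nlinarith [a₁, b₂]
  · rw [le_div_iff₀ hβδ]; nlinarith [a₂, b₁]

/-- **Double-occupancy bracket for a phase** (`0 < δ ≤ U`): `−βD(ω₁)δ ≤ P(U+δ) − P(U)` and `βD(ω₁)δ ≤ P(U−δ) − P(U)`,
`D(ω) = e_{Φ(0,0,1)}(ω)`. [cite: Griffiths1964] -/
theorem IsTorusLimitOfMixture.docc_brackets_of_mix_left
    (h₁ : ω₁.IsTranslationInvariant) (h₂ : ω₂.IsTranslationInvariant) {lam : ℝ} (hl0 : 0 < lam) (hl1 : lam ≤ 1)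
    (hω : (InfVolFermionState.mix lam hl0.le hl1 ω₁ ω₂).IsTorusLimitOfMixture sourcedGibbsCount (gcGibbsWeightTT' β t t' U μ hz)
      (gcGibbsVectorTT' t t' U μ hz) Ls)
    (hLs : Tendsto Ls atTop atTop) {δ : ℝ} (hδ : 0 < δ) (hδU : δ ≤ U) :
    -(β * ω₁.meanEnergy (hubbardTTPrimeFermionInteraction 0 0 1) 1 * δ) ≤
        gcPressureTT'Zeeman β t t' (U + δ) μ hz - gcPressureTT'Zeeman β t t' U μ hz ∧
      β * ω₁.meanEnergy (hubbardTTPrimeFermionInteraction 0 0 1) 1 * δ ≤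
        gcPressureTT'Zeeman β t t' (U - δ) μ hz - gcPressureTT'Zeeman β t t' U μ hz := by
  have hp := hω.gcPressureTT'Zeeman_sub_le_of_mix_left hβ t t' hU μ hz h₁ h₂ hl0 hl1 hLs hβ t t' (by linarith : 0 ≤ U + δ) μ hz
  have hm := hω.gcPressureTT'Zeeman_sub_le_of_mix_left hβ t t' hU μ hz h₁ h₂ hl0 hl1 hLs hβ t t' (by linarith : 0 ≤ U - δ) μ hz
  rw [ω₁.meanEnergy_hubbardTTPrime_affine t t' U t' (U + δ)] at hp
  rw [ω₁.meanEnergy_hubbardTTPrime_affine t t' U t' (U - δ)] at hm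
  simp only [sub_self, zero_mul, add_zero] at hp hm
  constructor
  · nlinarith [hp]
  · nlinarith [hm]

/-- **DOUBLE-OCCUPANCY JUMP BOUND** (`β > 0`, `0 < δ ≤ U`, `0 < λ < 1`): `|D(ω₁) − D(ω₂)| ≤ (P(U+δ) + P(U−δ) − 2P(U))/(βδ)`.
[cite: Israel1979, Thm. I.2.4] [cite: Griffiths1964] -/
theorem IsTorusLimitOfMixture.abs_docc_sub_le_of_mix (hβ' : 0 < β)
    (h₁ : ω₁.IsTranslationInvariant) (h₂ : ω₂.IsTranslationInvariant) {lam : ℝ} (hl0 : 0 < lam) (hl1 : lam < 1)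
    (hω : (InfVolFermionState.mix lam hl0.le hl1.le ω₁ ω₂).IsTorusLimitOfMixture sourcedGibbsCount (gcGibbsWeightTT' β t t' U μ hz)
      (gcGibbsVectorTT' t t' U μ hz) Ls)
    (hLs : Tendsto Ls atTop atTop) {δ : ℝ} (hδ : 0 < δ) (hδU : δ ≤ U) :
    |ω₁.meanEnergy (hubbardTTPrimeFermionInteraction 0 0 1) 1 - ω₂.meanEnergy (hubbardTTPrimeFermionInteraction 0 0 1) 1| ≤
      (gcPressureTT'Zeeman β t t' (U + δ) μ hz + gcPressureTT'Zeeman β t t' (U - δ) μ hz -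
        2 * gcPressureTT'Zeeman β t t' U μ hz) / (β * δ) := by
  obtain ⟨a₁, b₁⟩ := hω.docc_brackets_of_mix_left hβ t t' hU μ hz h₁ h₂ hl0 hl1.le hLs hδ hδU
  have hω' : (InfVolFermionState.mix (1 - lam) (by linarith) (by linarith) ω₂ ω₁).IsTorusLimitOfMixture sourcedGibbsCount
      (gcGibbsWeightTT' β t t' U μ hz) (gcGibbsVectorTT' t t' U μ hz) Ls := by
    rw [← mix_comm]; exact hω
  obtain ⟨a₂, b₂⟩ := hω'.docc_brackets_of_mix_left hβ t t' hU μ hz h₂ h₁ (by linarith) (by linarith) hLs hδ hδU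
  have hβδ : 0 < β * δ := mul_pos hβ' hδ
  rw [abs_sub_le_iff]
  constructor
  · rw [le_div_iff₀ hβδ]; nlinarith [b₁, a₂]
  · rw [le_div_iff₀ hβδ]; nlinarith [b₂, a₁]

/-- **Diagonal-hopping bracket for a phase**: `−βK₂(ω₁)δ ≤ P(t'+δ) − P(t')` and `βK₂(ω₁)δ ≤ P(t'−δ) − P(t')`, `K₂ = e_{Φ(0,1,0)}`.
[cite: Griffiths1964] -/
theorem IsTorusLimitOfMixture.diagHop_brackets_of_mix_left
    (h₁ : ω₁.IsTranslationInvariant) (h₂ : ω₂.IsTranslationInvariant) {lam : ℝ} (hl0 : 0 < lam) (hl1 : lam ≤ 1)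
    (hω : (InfVolFermionState.mix lam hl0.le hl1 ω₁ ω₂).IsTorusLimitOfMixture sourcedGibbsCount (gcGibbsWeightTT' β t t' U μ hz)
      (gcGibbsVectorTT' t t' U μ hz) Ls)
    (hLs : Tendsto Ls atTop atTop) (δ : ℝ) :
    -(β * ω₁.meanEnergy (hubbardTTPrimeFermionInteraction 0 1 0) 1 * δ) ≤
        gcPressureTT'Zeeman β t (t' + δ) U μ hz - gcPressureTT'Zeeman β t t' U μ hz ∧
      β * ω₁.meanEnergy (hubbardTTPrimeFermionInteraction 0 1 0) 1 * δ ≤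
        gcPressureTT'Zeeman β t (t' - δ) U μ hz - gcPressureTT'Zeeman β t t' U μ hz := by
  have hp := hω.gcPressureTT'Zeeman_sub_le_of_mix_left hβ t t' hU μ hz h₁ h₂ hl0 hl1 hLs hβ t (t' + δ) hU μ hz
  have hm := hω.gcPressureTT'Zeeman_sub_le_of_mix_left hβ t t' hU μ hz h₁ h₂ hl0 hl1 hLs hβ t (t' - δ) hU μ hz
  rw [ω₁.meanEnergy_hubbardTTPrime_affine t t' U (t' + δ) U] at hp
  rw [ω₁.meanEnergy_hubbardTTPrime_affine t t' U (t' - δ) U] at hm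
  simp only [sub_self, zero_mul, add_zero] at hp hm
  constructor
  · nlinarith [hp]
  · nlinarith [hm]

/-- **DIAGONAL-HOPPING JUMP BOUND** (`β > 0`, `δ > 0`, `0 < λ < 1`): `|K₂(ω₁) − K₂(ω₂)| ≤ (P(t'+δ) + P(t'−δ) − 2P(t'))/(βδ)`.
[cite: Israel1979, Thm. I.2.4] [cite: Griffiths1964] -/
theorem IsTorusLimitOfMixture.abs_diagHop_sub_le_of_mix (hβ' : 0 < β)
    (h₁ : ω₁.IsTranslationInvariant) (h₂ : ω₂.IsTranslationInvariant) {lam : ℝ} (hl0 : 0 < lam) (hl1 : lam < 1)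
    (hω : (InfVolFermionState.mix lam hl0.le hl1.le ω₁ ω₂).IsTorusLimitOfMixture sourcedGibbsCount (gcGibbsWeightTT' β t t' U μ hz)
      (gcGibbsVectorTT' t t' U μ hz) Ls)
    (hLs : Tendsto Ls atTop atTop) {δ : ℝ} (hδ : 0 < δ) :
    |ω₁.meanEnergy (hubbardTTPrimeFermionInteraction 0 1 0) 1 - ω₂.meanEnergy (hubbardTTPrimeFermionInteraction 0 1 0) 1| ≤
      (gcPressureTT'Zeeman β t (t' + δ) U μ hz + gcPressureTT'Zeeman β t (t' - δ) U μ hz -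
        2 * gcPressureTT'Zeeman β t t' U μ hz) / (β * δ) := by
  obtain ⟨a₁, b₁⟩ := hω.diagHop_brackets_of_mix_left hβ t t' hU μ hz h₁ h₂ hl0 hl1.le hLs δ
  have hω' : (InfVolFermionState.mix (1 - lam) (by linarith) (by linarith) ω₂ ω₁).IsTorusLimitOfMixture sourcedGibbsCount
      (gcGibbsWeightTT' β t t' U μ hz) (gcGibbsVectorTT' t t' U μ hz) Ls := by
    rw [← mix_comm]; exact hω
  obtain ⟨a₂, b₂⟩ := hω'.diagHop_brackets_of_mix_left hβ t t' hU μ hz h₂ h₁ (by linarith) (by linarith) hLs δ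
  have hβδ : 0 < β * δ := mul_pos hβ' hδ
  rw [abs_sub_le_iff]
  constructor
  · rw [le_div_iff₀ hβδ]; nlinarith [b₁, a₂]
  · rw [le_div_iff₀ hβδ]; nlinarith [b₂, a₁]

end InfVolFermionState

end Literature.MathematicalPhysics.QuantumLattice

end
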